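import Literature.Barriers.QuantumAdvantage.PPolyOraclesThm76Frontier
import Literature.Barriers.QuantumAdvantage.PPolyOraclesThm76Quantum
import Literature.Barriers.QuantumAdvantage.PPolyOraclesBridgesProofs
import HarnessLib
import Summits.PneNP.PneNP.Theorems.OWFExist

/-!
# Barrier `PPolyOracles` (Aaronson–Chen 2017, Thms. 7.6 and 8.1): the §7.2–7.3 fact discharged; Thm. 7.6 and the barrier from pseudorandom generators, i.e. modulo HILL alone

Sibling proof file of `Literature/Barriers/QuantumAdvantage/PPolyOracles.lean` (the barrier
`PPolyOracles = aaronsonChen2017_thm76 ∧ aaronsonChen2017_thm81`; S. Aaronson, L. Chen,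
*Complexity-theoretic foundations of quantum supremacy experiments*, CCC 2017, arXiv:1612.05903
[AaronsonChen2017], **Thm. 7.6** (p. 30): "Assuming one-way functions exist, there exists an oracle
`O ∈ P/poly` such that `BPP^O ≠ BQP^O`", **Thm. 8.1** (p. 32)) and of its decomposition
(`PPolyOraclesProofs.lean`, `PPolyOraclesThm76*.lean`, `PPolyOraclesLemma82Proofs.lean`).

The printed proof of Thm. 7.6 (p. 30) has two ingredients: Lemma 7.4 (p. 29), "If one-way
functions exist, then there exist secure PRFs and PRPs", which the paper CITES
("[HILL99, GGM86, GL89, LR88]") and does not prove; and §7.2–7.3 proper (Zhandry's `PRP^raw` /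
`PRF^mod`, Lemma 7.5, the diagonalization), which it proves. With the landing of the quantum half
of Lemma 7.5 (`aaronsonChen2017_lem75_quantum_holds`, `PPolyOraclesThm76Quantum.lean`:
Boneh–Lipton / Shor period finding as ONE uniform Clifford+T oracle family) every leaf of the
second ingredient is a theorem of the tree, and of Lemma 7.4 the links GGM
(`PRFExist_of_PRGExist_holds`) and Luby–Rackoff (`PRPExist_of_luby_rackoff`, from
`LubyRackoff.HybridStep_holds` and `LubyRackoff.MainLemma_holds`) are theorems as well. This file
records the resulting state, adding NO definition and NO named fact:

* `aaronsonChen2017_thm76_of_prp_holds` — the named fact `aaronsonChen2017_thm76_of_prp :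
  PRPExist → PPolyOracleSeparation` of `PPolyOraclesProofs.lean` (§7.2–7.3: "by Lemma 7.4, let
  `PRP^raw` be a secure pseudorandom permutation … Hence `BPP^O ≠ BQP^O`") HOLDS;
* `pPolyOracleSeparation_of_PRFExist`, `pPolyOracleSeparation_of_PRGExist` — hence a `P/poly`
  oracle separating `BPP` from `BQP` exists as soon as pseudorandom functions, resp. pseudorandom
  GENERATORS, exist (Thm. 7.6 with the HILL step of Lemma 7.4 factored out), and the sampling form
  `pPolyOracleSamplingSeparation_of_PRGExist` (§1.3, p. 10: "Relative to some efficiently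
  computable oracle, we can prove `SampBPP ≠ SampBQP`, but only under a weak computational
  assumption") through the discharged bridges (`PPolyOracleSeparation.samplingSeparation`);
* `aaronsonChen2017_thm76_of_HILL`, `PPolyOracles_of_HILL` (hypothesis: the named fact
  `PRGExist_iff_OWFExist`, Håstad–Impagliazzo–Levin–Luby 1999, Thm. 1.1) and
  `aaronsonChen2017_thm76_of_hill`, `PPolyOracles_of_hill` (hypothesis: its hard direction
  `OWFExist → PRGExist` only; the easy direction is the tree theorem `OWFExist_of_PRGExist`) —
  Thm. 7.6 as printed and the barrier conjunction from HILL ALONE, Thm. 8.1 being the tree theorem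
  `aaronsonChen2017_thm81_holds`.

So the discharges `aaronsonChen2017_thm76_holds` and `PPolyOracles_holds` are the one-liners
`aaronsonChen2017_thm76_of_HILL PRGExist_iff_OWFExist_holds` and
`PPolyOracles_of_HILL PRGExist_iff_OWFExist_holds`, to be appended here when HILL lands
(`Literature/Computability/Cryptography/HILL*.lean`, in progress). No HILL-free proof of Thm. 7.6 as
printed is known: every known route from one-way functions to the pseudorandom objects of §7.2
passes through a pseudorandom generator [cite: AaronsonChen2017, Lemma 7.4 (p. 29)].

## References

* S. Aaronson, L. Chen, CCC 2017, arXiv:1612.05903: §1.3 (p. 10), Lemma 7.4 (p. 29), Lemma 7.5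
  (p. 30), Thm. 7.6 and its proof (p. 30), Thm. 8.1 (p. 32), App. 13 (p. 42) [AaronsonChen2017].
* J. Håstad, R. Impagliazzo, L. A. Levin, M. Luby, SIAM J. Comput. 28 (1999), Thm. 1.1
  [HastadImpagliazzoLevinLuby1999].
* O. Goldreich, R. Goldwasser, S. Micali, J. ACM 33 (1986), Thm. 3 [GoldreichGoldwasserMicali1986].
* M. Luby, C. Rackoff, SIAM J. Comput. 17 (1988), Thm. 1 [LubyRackoff1988].
* O. Goldreich, *Foundations of Cryptography I*, CUP 2001, §3.3.6 [Goldreich2001].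
-/

namespace Literature.Barriers.QuantumAdvantage

open Literature.Computability.Complexity Literature.Computability.Cryptography

/-! ### §7.2–7.3: a secure PRP gives the `P/poly` oracle — discharged -/

/-- **Aaronson–Chen 2017, §7.2–7.3 — the named fact `aaronsonChen2017_thm76_of_prp` holds**: from
any classically secure pseudorandom permutation (`PRPExist`) there is an oracle language
`O ∈ P/poly` with `BPP^O ≠ BQP^O`. All five leaves of the proved diagonalization
(`aaronsonChen2017_thm76_of_prp_of_leaves₂`) are theorems: Lemma 7.5 (1) both halves
(`aaronsonChen2017_lem75_prp_isPRF_holds`, `aaronsonChen2017_lem75_prfMod_isPRF_holds`), the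
compilation of `BPP^O` machines (`acLang_bppCompiles_holds`), the `P/poly` bound
(`aaronsonChen2017_thm76_ppoly_holds`), and now Lemma 7.5 (2)–(3) with the `BQP^O` machine
(`aaronsonChen2017_lem75_quantum_holds`).
[cite: AaronsonChen2017, §7.2, Lemma 7.5 and proof of Thm. 7.6 (pp. 29–30), App. 13 (p. 42)] -/
theorem aaronsonChen2017_thm76_of_prp_holds : aaronsonChen2017_thm76_of_prp :=
  aaronsonChen2017_thm76_of_prp_of_quantum aaronsonChen2017_lem75_quantum_holds

/-- Applied form: a secure PRP yields an oracle `O ∈ P/poly` with `BPP^O ≠ BQP^O`.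
[cite: AaronsonChen2017, proof of Thm. 7.6 (p. 30)] -/
theorem pPolyOracleSeparation_of_PRPExist (h : PRPExist) : PPolyOracleSeparation :=
  aaronsonChen2017_thm76_of_prp_holds h

/-- **From pseudorandom functions** (Luby–Rackoff, the tree theorem `PRPExist_of_luby_rackoff`,
then §7.2–7.3). [cite: AaronsonChen2017, Lemma 7.4 (p. 29) and Thm. 7.6 (p. 30)]
[cite: LubyRackoff1988, Thm. 1] -/
theorem pPolyOracleSeparation_of_PRFExist (h : PRFExist) : PPolyOracleSeparation :=
  pPolyOracleSeparation_of_PRPExist (PRPExist_of_luby_rackoff h)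

/-- **Thm. 7.6 with the HILL step factored out: if pseudorandom GENERATORS exist, then there is an
oracle `O ∈ P/poly` with `BPP^O ≠ BQP^O`** (GGM, the tree theorem `PRFExist_of_PRGExist_holds`,
then Luby–Rackoff and §7.2–7.3). Unconditional in the tree.
[cite: AaronsonChen2017, Lemma 7.4 (p. 29) and Thm. 7.6 (p. 30)]
[cite: GoldreichGoldwasserMicali1986, Thm. 3] -/
theorem pPolyOracleSeparation_of_PRGExist (h : PRGExist) : PPolyOracleSeparation :=
  pPolyOracleSeparation_of_PRFExist (PRFExist_of_PRGExist_holds h)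

/-- The sampling form from pseudorandom generators: some `O ∈ P/poly` has
`SampBPP^O ≠ SampBQP^O` (through the discharged bridges,
`PPolyOracleSeparation.samplingSeparation`). [cite: AaronsonChen2017, §1.3 (p. 10) and Thm. 7.6 (p. 30)] -/
theorem pPolyOracleSamplingSeparation_of_PRGExist (h : PRGExist) : PPolyOracleSamplingSeparation :=
  (pPolyOracleSeparation_of_PRGExist h).samplingSeparation

/-! ### Thm. 7.6 and the barrier modulo HILL alone -/

/-- **Thm. 7.6 as printed, from the named fact HILL** (`PRGExist_iff_OWFExist`,
Håstad–Impagliazzo–Levin–Luby: pseudorandom generators exist iff one-way functions exist) — the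
only hypothesis left on the line of `aaronsonChen2017_thm76_of_frontier₂`. The discharge
`aaronsonChen2017_thm76_holds` is this theorem applied to `PRGExist_iff_OWFExist_holds`.
[cite: AaronsonChen2017, Thm. 7.6 (p. 30) and Lemma 7.4 (p. 29)]
[cite: HastadImpagliazzoLevinLuby1999, Thm. 1.1] -/
theorem aaronsonChen2017_thm76_of_HILL (hHILL : PRGExist_iff_OWFExist) : aaronsonChen2017_thm76 :=
  aaronsonChen2017_thm76_of_frontier₂ hHILL aaronsonChen2017_lem75_quantum_holds

/-- **Thm. 7.6 as printed, from the hard direction of HILL only** (`OWFExist → PRGExist`; the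
converse is the tree theorem `OWFExist_of_PRGExist`). [cite: AaronsonChen2017, Thm. 7.6 (p. 30)]
[cite: HastadImpagliazzoLevinLuby1999, Thm. 1.1] [cite: Goldreich2001, §3.3.6] -/
theorem aaronsonChen2017_thm76_of_hill (hHILL : Summit.PneNP.PneNP.OWFExist → PRGExist) : aaronsonChen2017_thm76 :=
  fun howf => pPolyOracleSeparation_of_PRGExist (hHILL howf)

/-- **The barrier `PPolyOracles` (Thm. 7.6 ∧ Thm. 8.1) from HILL alone**, Thm. 8.1 being the tree
theorem `aaronsonChen2017_thm81_holds` (`PPolyOracles_of_thm76`). The discharge `PPolyOracles_holds`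
is this theorem applied to `PRGExist_iff_OWFExist_holds`.
[cite: AaronsonChen2017, Thm. 7.6 (p. 30) and Thm. 8.1 (p. 32)]
[cite: HastadImpagliazzoLevinLuby1999, Thm. 1.1] -/
theorem PPolyOracles_of_HILL (hHILL : PRGExist_iff_OWFExist) : PPolyOracles :=
  PPolyOracles_of_thm76 (aaronsonChen2017_thm76_of_HILL hHILL)

/-- The barrier from the hard direction of HILL only. [cite: AaronsonChen2017, Thm. 7.6 and Thm. 8.1]
[cite: HastadImpagliazzoLevinLuby1999, Thm. 1.1] -/
theorem PPolyOracles_of_hill (hHILL : Summit.PneNP.PneNP.OWFExist → PRGExist) : PPolyOracles :=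
  PPolyOracles_of_thm76 (aaronsonChen2017_thm76_of_hill hHILL)

/-- **Both evasions of the barrier from HILL alone**: one-way functions then give an efficiently
computable oracle separating the language classes AND one separating the approximate sampling
classes. [cite: AaronsonChen2017, §1.3 (pp. 9–10), Thm. 7.6 (p. 30)] -/
theorem separations_of_hill (hHILL : Summit.PneNP.PneNP.OWFExist → PRGExist) (howf : Summit.PneNP.PneNP.OWFExist) :
    PPolyOracleSeparation ∧ PPolyOracleSamplingSeparation :=
  ⟨pPolyOracleSeparation_of_PRGExist (hHILL howf), pPolyOracleSamplingSeparation_of_PRGExist (hHILL howf)⟩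

end Literature.Barriers.QuantumAdvantage
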